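import Mathlib
import Literature.NumberTheory.LFunctions.Zhang2022.Section16Varpi2LocalMajorant
import Literature.NumberTheory.LFunctions.Zhang2022.Section16BRoughMajorant
import Literature.NumberTheory.LFunctions.Zhang2022.Section16BStep16u031Rankin
import HarnessLib

/-!
# Zhang (2022) §16 Block A: the local majorant in MASTER form (no smoothness / size guard) and the
# by-name closers of `Inline16_nsetRemovable(E)` and `Step16_u031Lε`

Topic `Literature/NumberTheory/LFunctions/Zhang2022` (Landau–Siegel audit tree; verdict-neutral).
Y. Zhang, *Discrete mean estimates and the Landau–Siegel zero*, arXiv:2211.02515v1 (2022)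
[Zhang2022LandauSiegel] — **an unrefereed manuscript under adjudication**; nothing here bears on its
Theorems 1–2. ZHANG-L discharge lane (WP16, seat zl-w16-p4; RULINGS W16-S5a/S5b).

* `varpi2_localMajorant_master` — the pointwise majorant `|ϖ₂ⱼ(n₁)|τ₃(n₁) ≤ K₀∏_{q^r∥n₁}a(q,r)` for
  EVERY `n₁ ≥ 1` (the proof of `varpi2_localMajorant` uses neither `n₁ ∈ 𝒩(𝔮)` nor `n₁ < T`);
  `varpi2_localMajorant_bigP` — the same with the guard `n₁ < P` (zl-libA-p2's `hloc′`, the input of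
  `step16_u031Lε_of_localMajorant`);
* closers BY NAME: `step16_u031Lε_holds (c') : Step16_u031Lε c'` (u031 in the `ε₁`-reading of
  record, via zl-libA-p2's Rankin edge), `inline16_nsetRemovable_holds (c') : Inline16_nsetRemovable c'`
  and `inline16_nsetRemovableE_holds (e1pp) (c') : Inline16_nsetRemovableE e1pp c'` (via zl-w16-p2's
  `inline16_nsetRemovable(E)_of_weightSum` over (R) = `varpi2loc_roughMajorant`, and
  `inline16_varpi2WeightSum_holds`).

Theorems only; no definitions, no named facts.

## References

* Y. Zhang, arXiv:2211.02515v1 (2022), §16 pp. 93–94 (tex L4596–L4640). [cite: Zhang2022LandauSiegel, §16 (16.15) p.94]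
-/

noncomputable section

open Complex Real Finset
open Literature.NumberTheory.LFunctions.Zhang2022
open Literature.NumberTheory.LFunctions.Zhang2022.Skeleton
open Literature.NumberTheory.LFunctions.Zhang2022.Typed.Section16A
open Literature.NumberTheory.LFunctions.Zhang2022.AppendixA

namespace Literature.NumberTheory.LFunctions.Zhang2022.Typed.Section16B

/-! ## §1. The master form -/

set_option maxHeartbeats 1600000 in
/-- **The local multiplicative majorant of `|ϖ₂ⱼ(n₁)|τ₃(n₁)`, master form** (every `n₁ ≥ 1`; no
smoothness, no size guard): `K₀ = e^{450}/c₀`, `C₀ = 1323756`, weights `a(q,1) = 6 + C₀(q⁻¹ + α𝓛 log q)`,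
`a(q,r) = C₀(3/2)^r`. Same proof as `varpi2_localMajorant`. [cite: Zhang2022LandauSiegel, §16 (16.15) p.94] -/
theorem varpi2_localMajorant_master (c' : ℝ) :
    ∃ K₀ C₀ : ℝ, 0 ≤ K₀ ∧ 0 ≤ C₀ ∧ ForAllLarge fun D _ χ => AssumptionA D χ →
      ∀ j ∈ ({1, 2} : Finset ℕ), ∀ n₁ : ℕ, n₁ ≠ 0 →
        ‖varpi2 c' χ j n₁‖ * tau3R n₁ ≤ K₀ * ∏ q ∈ n₁.primeFactors,
          (if n₁.factorization q = 1 then 6 + C₀ * ((q : ℝ)⁻¹ + alpha D * ell D * Real.log q)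
            else C₀ * (3 / 2 : ℝ) ^ n₁.factorization q) := by
  obtain ⟨c₀, hc₀, D₀, hM⟩ := inline16_calM2starLarge_of_lemma161 c' (AppendixA.lemma161_holds c')
  obtain ⟨D₁, hD₁⟩ := exists_forall_le_ell (max 2 (Real.pi * (5 * |c'| + 1)))
  refine ⟨Real.exp 450 / c₀, 1323756, by positivity, by norm_num, max D₀ D₁,
    fun D _ χ hD hq hp hA j hj n₁ hn₁ => ?_⟩
  have hD₀ : D₀ ≤ D := le_trans (le_max_left _ _) hD
  have hL := hD₁ D (le_trans (le_max_right _ _) hD)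
  have hℓ2 : 2 ≤ ell D := le_trans (le_max_left _ _) hL
  have hℓπ : Real.pi * (5 * |c'| + 1) ≤ ell D := le_trans (le_max_right _ _) hL
  have hℓ0 : 0 < ell D := by linarith
  have hα0 : 0 < alpha D := Skeleton.alpha_pos_of_ell_pos hℓ0
  have hβ : ‖betaJ c' D j‖ < 5 * alpha D := norm_betaJ_lt_five_alpha hℓ2 hℓπ hj
  set s : ℂ := 1 - betaJ c' D j with hs
  have hMs : c₀ ≤ ‖calM2star c' χ s‖ := by
    refine hM D χ hD₀ hq hp hA s ?_
    rw [hs, sub_sub_cancel_left, norm_neg]; exact hβ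
  have hn0 : n₁ ≠ 0 := hn₁
  obtain ⟨E, hE, hsplit⟩ := calM2_eq_const_mul_prod c' χ j hn0
  -- factor `E/𝓜₂*` out of `ϖ₂ⱼ(n₁)`
  have hfac : varpi2 c' χ j n₁ = E / calM2star c' χ s *
      ∑ x ∈ n₁.divisorsAntidiagonal, lam2 c' χ x.1 1 * (x.1 : ℂ) ^ betaJ c' D j * χ (x.2 : ZMod D) *
        ∏ q ∈ n₁.primeFactors, calM2Factor c' χ q x.1 x.2 s := by
    unfold varpi2
    rw [Finset.mul_sum]
    refine Finset.sum_congr rfl fun x hx => ?_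
    rw [← hs, hsplit x hx]
    ring
  have hvarpi : ‖varpi2 c' χ j n₁‖ ≤ Real.exp 450 / c₀ *
      ((n₁.divisors.card : ℝ) * ∏ q ∈ n₁.primeFactors, ((1 + 66 / (q : ℝ)) * (1 + 2882 / (q : ℝ)))) := by
    rw [hfac, norm_mul, norm_div]
    refine mul_le_mul ?_ (norm_inner_sum_le c' χ j hn0) (norm_nonneg _) (by positivity)
    exact div_le_div₀ (by positivity) hE hc₀ hMs
  -- multiply by `τ₃(n₁)` and regroup prime by prime
  have hτ0 : 0 ≤ tau3R n₁ := Finset.sum_nonneg fun _ _ => Nat.cast_nonneg _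
  have hcard : (n₁.divisors.card : ℝ) = ∏ q ∈ n₁.primeFactors, (((n₁.factorization q : ℕ) : ℝ) + 1) := by
    rw [Nat.card_divisors hn0, Nat.cast_prod]
    push_cast
    rfl
  have hregroup : (n₁.divisors.card : ℝ) *
      (∏ q ∈ n₁.primeFactors, ((1 + 66 / (q : ℝ)) * (1 + 2882 / (q : ℝ)))) * tau3R n₁ =
      ∏ q ∈ n₁.primeFactors, ((((n₁.factorization q : ℕ) : ℝ) + 1) *
        ((((n₁.factorization q : ℕ) : ℝ) + 1) * ((n₁.factorization q : ℕ) + 2) / 2) *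
          ((1 + 66 / (q : ℝ)) * (1 + 2882 / (q : ℝ)))) := by
    rw [hcard, tau3R_eq_prod hn0, ← Finset.prod_mul_distrib, ← Finset.prod_mul_distrib]
    exact Finset.prod_congr rfl fun q _ => by ring
  have hweights : ∏ q ∈ n₁.primeFactors, ((((n₁.factorization q : ℕ) : ℝ) + 1) *
        ((((n₁.factorization q : ℕ) : ℝ) + 1) * ((n₁.factorization q : ℕ) + 2) / 2) *
          ((1 + 66 / (q : ℝ)) * (1 + 2882 / (q : ℝ)))) ≤
      ∏ q ∈ n₁.primeFactors,
        (if n₁.factorization q = 1 then 6 + 1323756 * ((q : ℝ)⁻¹ + alpha D * ell D * Real.log q)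
          else 1323756 * (3 / 2 : ℝ) ^ n₁.factorization q) := by
    refine Finset.prod_le_prod (fun q _ => by positivity) fun q hq' => ?_
    have hqp : q.Prime := Nat.prime_of_mem_primeFactors hq'
    have hr1 : 1 ≤ n₁.factorization q := by
      rw [Nat.one_le_iff_ne_zero, ← Finsupp.mem_support_iff, Nat.support_factorization]; exact hq'
    have hT : 0 ≤ alpha D * ell D * Real.log q :=
      mul_nonneg (mul_nonneg hα0.le hℓ0.le) (Real.log_natCast_nonneg q)
    exact local_weight_le hqp.two_le hr1 hT
  have hK : 0 ≤ Real.exp 450 / c₀ := by positivity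
  calc ‖varpi2 c' χ j n₁‖ * tau3R n₁
      ≤ Real.exp 450 / c₀ * ((n₁.divisors.card : ℝ) *
          ∏ q ∈ n₁.primeFactors, ((1 + 66 / (q : ℝ)) * (1 + 2882 / (q : ℝ)))) * tau3R n₁ :=
        mul_le_mul_of_nonneg_right hvarpi hτ0
    _ = Real.exp 450 / c₀ * ((n₁.divisors.card : ℝ) *
          (∏ q ∈ n₁.primeFactors, ((1 + 66 / (q : ℝ)) * (1 + 2882 / (q : ℝ)))) * tau3R n₁) := by ring
    _ ≤ Real.exp 450 / c₀ * ∏ q ∈ n₁.primeFactors,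
          (if n₁.factorization q = 1 then 6 + 1323756 * ((q : ℝ)⁻¹ + alpha D * ell D * Real.log q)
            else 1323756 * (3 / 2 : ℝ) ^ n₁.factorization q) := by
        rw [hregroup]; exact mul_le_mul_of_nonneg_left hweights hK


/-- **`hloc′` — the majorant with the guard `n₁ < P`** (zl-libA-p2's input for the Rankin step u031).
[cite: Zhang2022LandauSiegel, §16 p.93 (u031)] -/
theorem varpi2_localMajorant_bigP (c' : ℝ) :
    ∃ K₀ C₀ : ℝ, 0 ≤ K₀ ∧ 0 ≤ C₀ ∧ ForAllLarge fun D _ χ => AssumptionA D χ →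
      ∀ j ∈ ({1, 2} : Finset ℕ), ∀ n₁ : ℕ, n₁ ∈ nset (frakq D) → (n₁ : ℝ) < bigP D →
        ‖varpi2 c' χ j n₁‖ * tau3R n₁ ≤ K₀ * ∏ q ∈ n₁.primeFactors,
          (if n₁.factorization q = 1 then 6 + C₀ * ((q : ℝ)⁻¹ + alpha D * ell D * Real.log q)
            else C₀ * (3 / 2 : ℝ) ^ n₁.factorization q) := by
  obtain ⟨K₀, C₀, hK₀, hC₀, h⟩ := varpi2_localMajorant_master c'
  exact ⟨K₀, C₀, hK₀, hC₀, h.mono fun D _ χ _ _ hD hA j hj n₁ hn₁ _ => hD hA j hj n₁ hn₁.1.ne'⟩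

/-! ## §2. Closers by name -/

/-- **`Z22:§16.u031` in the reading of record (`Step16_u031Lε`) HOLDS** for every `c′`
(zl-libA-p2's `step16_u031Lε_of_localMajorant` on `varpi2_localMajorant_bigP`).
[cite: Zhang2022LandauSiegel, §16 p.93 (u031)] -/
theorem step16_u031Lε_holds (c' : ℝ) : Step16_u031Lε c' :=
  step16_u031Lε_of_localMajorant c' (varpi2_localMajorant_bigP c')

/-- **`Typed.Section16B.Inline16_nsetRemovable c′` HOLDS** for every `c′` (zl-w16-p2's (R) + the weight
sum). [cite: Zhang2022LandauSiegel, §16 (16.15) p.94] -/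
theorem inline16_nsetRemovable_holds (c' : ℝ) : Inline16_nsetRemovable c' :=
  inline16_nsetRemovable_of_weightSum c' (inline16_varpi2WeightSum_holds c')

variable (c' : ℝ) in
/-- `Inline16_nsetRemovable` — `_holds` alias of `inline16_nsetRemovable_holds` above under the fact's exact name, stated under the
prover's own binders as section variables (appended 2026-08-28, D-0026 bookkeeping: the proof term is the
existing theorem of this file; no statement, definition or attribute is edited; no new named fact; the
ledger's debt table listed the fact unproved). [cite: Zhang2022LandauSiegel, §16 (16.15) p.94] -/
theorem _root_.Literature.NumberTheory.LFunctions.Zhang2022.Typed.Section16B.Inline16_nsetRemovable_holds :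
    _root_.Literature.NumberTheory.LFunctions.Zhang2022.Typed.Section16B.Inline16_nsetRemovable c' :=
  _root_.Literature.NumberTheory.LFunctions.Zhang2022.Typed.Section16B.inline16_nsetRemovable_holds (c' := c')

/-- **`Typed.Section16B.Inline16_nsetRemovableE e1pp c′` HOLDS** for every `e1pp`, `c′`.
[cite: Zhang2022LandauSiegel, §16 (16.15) p.94] -/
theorem inline16_nsetRemovableE_holds (e1pp : ℕ → ℂ) (c' : ℝ) : Inline16_nsetRemovableE e1pp c' :=
  inline16_nsetRemovableE_of_weightSum e1pp c' (inline16_varpi2WeightSum_holds c')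

end Literature.NumberTheory.LFunctions.Zhang2022.Typed.Section16B

end
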